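import Literature.NumberTheory.DiophantineGeometry.ApproximationBoundRatArchOfCoreProofs
import Literature.NumberTheory.DiophantineGeometry.ApproximationBoundRatPadicOfCoresProofs
import HarnessLib

/-!
# The approximation bound over `ℚ` ("A1.L", `∃ K ≥ 1, PastenApproximationBound K`) from the three
# engine texts in SHAPE form (archimedean core, odd-`p` core, `2`-adic core)

Topic `NumberTheory/DiophantineGeometry`; namespace `Literature.NumberTheory.DiophantineGeometry.Dioph`.
Proofs only: no definition, no named fact. Closing file of the companion set
`ApproximationBoundRat{Padic{Units,CaseA,OfCore,Dependence,OfCores},Arch{Dependence,OfCore}}Proofs`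
(cell `abc-stewartyu`, support chains "ArchShapeChain" / "PadicShapeChain" / "HalvesJoin" of the
planned library rung "A1.L").

* `indepArch_of_archCore` — the archimedean core on any finite index type from its `Fin r` text;
* `archApproximationBound_rat_of_archCore (hArch)` — the archimedean half ("A1.L(∞)") from ONE
  hypothesis, the text of Nesterenko 2003 Thm 2.2 (= Matveev 2000 over `ℚ`) in the `cʳ` shape;
* `approximationBound_rat_of_cores (hArch) (hOdd) (hTwo) : approximationBound_rat` — both halves
  joined (`approximationBound_rat_of_halves`).

None of the three hypotheses is proved in the tree; they are lower bounds for (p-adic) linear forms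
in logarithms in the published shape with unspecified absolute constants.

## References

* [Nesterenko2003] Yu. V. Nesterenko, *Linear forms in logarithms of rational numbers*, LNM 1819
  (2003) — Thm 2.2.
* [Yu2007] K. Yu, *p-adic logarithmic forms and group varieties III*, Forum Math. 19 (2007) —
  Main Theorem (`K = ℚ`).
* [Pasten2024] H. Pasten, Invent. Math. 236 (2024) — Theorem 2.1 (`d = 1`).
* [EvertseGyory2015] J.-H. Evertse, K. Győry, CUP 2015 — Thm 4.2.1, §4.4.2.
-/

noncomputable section

open Finset Real Height

namespace Literature.NumberTheory.DiophantineGeometry.Dioph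

/-! ### `Fin r`-reindexing of the archimedean core -/

/-- **The archimedean core on an arbitrary finite index type** (from its `Fin r` text, any constant
`C₀ ≥ max 1 |c|`; reindexing along `Fintype.equivFin`). [cite: Nesterenko2003, Thm 2.2] -/
theorem indepArch_of_archCore {c : ℝ}
    (hArch : ∀ (r : ℕ) (a : Fin r → ℚ) (b : Fin r → ℤ) (A : Fin r → ℝ) (B : ℝ),
      (∀ i, 0 < a i) → (∀ μ : Fin r → ℤ, ∏ i, a i ^ μ i = 1 → μ = 0) →
      (∀ i, Height.logHeight₁ (a i) ≤ A i) → (∀ i, 1 ≤ A i) →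
      b ≠ 0 → (∀ i, (|b i| : ℝ) ≤ B) →
      -(c ^ r * (∏ i, A i) * Real.log (Real.exp 1 * B)) ≤
        Real.log |∑ i, (b i : ℝ) * Real.log (a i : ℝ)|)
    {C₀ : ℝ} (hcC : max 1 |c| ≤ C₀)
    (κ : Type) [Fintype κ] [DecidableEq κ] (a : κ → ℚ) (b : κ → ℤ) (A : κ → ℝ) (B : ℝ)
    (ha : ∀ k, 0 < a k) (hind : ∀ μ : κ → ℤ, ∏ k, a k ^ μ k = 1 → μ = 0)
    (hA : ∀ k, logHeight₁ (a k) ≤ A k) (hA1 : ∀ k, 1 ≤ A k) (hb : b ≠ 0)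
    (hB : ∀ k, (|b k| : ℝ) ≤ B) :
    -(C₀ ^ Fintype.card κ * (∏ k, A k) * Real.log (Real.exp 1 * B)) ≤
      Real.log |∑ k, (b k : ℝ) * Real.log (a k : ℝ)| := by
  set r := Fintype.card κ with hr
  set e : κ ≃ Fin r := Fintype.equivFin κ with he
  have hprod : ∀ (f : κ → ℤ), ∏ i : Fin r, a (e.symm i) ^ f (e.symm i) = ∏ k, a k ^ f k :=
    fun f => Fintype.prod_equiv e.symm _ _ fun i => rfl
  have hprodA : ∏ i : Fin r, A (e.symm i) = ∏ k, A k := Fintype.prod_equiv e.symm _ _ fun i => rfl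
  have hsum : ∑ i : Fin r, (b (e.symm i) : ℝ) * Real.log (a (e.symm i) : ℝ) =
      ∑ k, (b k : ℝ) * Real.log (a k : ℝ) := Fintype.sum_equiv e.symm _ _ fun i => rfl
  have hind' : ∀ μ : Fin r → ℤ, ∏ i, a (e.symm i) ^ μ i = 1 → μ = 0 := by
    intro μ hμ
    have h1 : ∏ k, a k ^ μ (e k) = 1 := by
      rw [← hprod (fun k => μ (e k))]
      simp only [Equiv.apply_symm_apply]
      exact hμ
    have h2 := hind (fun k => μ (e k)) h1
    funext i
    have := congrFun h2 (e.symm i)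
    simpa using this
  have hb' : (fun i : Fin r => b (e.symm i)) ≠ 0 := by
    intro h0; apply hb; funext k
    have := congrFun h0 (e k)
    simpa using this
  have h := hArch r (fun i => a (e.symm i)) (fun i => b (e.symm i)) (fun i => A (e.symm i)) B
    (fun i => ha _) hind' (fun i => hA _) (fun i => hA1 _) hb' (fun i => hB _)
  rw [hprodA, hsum] at h
  -- `c^r ≤ C₀^r` against a non-negative factor
  have hB1 : 1 ≤ B := by
    obtain ⟨k, hk⟩ : ∃ k, b k ≠ 0 := by
      by_contra h0; push Not at h0; exact hb (funext h0)
    have h1 : (1 : ℝ) ≤ |(b k : ℝ)| := by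
      have : (1 : ℤ) ≤ |b k| := Int.one_le_abs hk
      exact_mod_cast this
    exact h1.trans (hB k)
  have hX : 0 ≤ (∏ k, A k) * Real.log (Real.exp 1 * B) := by
    have h1 : 0 ≤ ∏ k, A k := Finset.prod_nonneg fun k _ => le_trans zero_le_one (hA1 k)
    have h2 : 0 ≤ Real.log (Real.exp 1 * B) :=
      Real.log_nonneg (by nlinarith [Real.add_one_le_exp (1 : ℝ)])
    positivity
  have hcr : c ^ r ≤ C₀ ^ r :=
    le_trans (le_abs_self _) (by
      rw [abs_pow]; exact pow_le_pow_left₀ (abs_nonneg c) ((le_max_right _ _).trans hcC) r)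
  have h3 : c ^ r * ((∏ k, A k) * Real.log (Real.exp 1 * B)) ≤
      C₀ ^ r * ((∏ k, A k) * Real.log (Real.exp 1 * B)) := mul_le_mul_of_nonneg_right hcr hX
  calc -(C₀ ^ r * (∏ k, A k) * Real.log (Real.exp 1 * B))
      ≤ -(c ^ r * (∏ k, A k) * Real.log (Real.exp 1 * B)) := by linarith
    _ ≤ _ := h

/-! ### The archimedean half and the full bound -/

/-- **The archimedean approximation bound over `ℚ` ("A1.L(∞)") from the archimedean core in shape
form.** `archApproximationBound_rat` (Pasten 2024 Thm 2.1 (i), `d = 1`, `∃ K ≥ 1`) follows from the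
text of Nesterenko 2003 Thm 2.2 / Matveev 2000 over `ℚ` in the `cʳ` shape (positive independent
rationals, weights `h(aᵢ) ≤ Aᵢ`, `1 ≤ Aᵢ`, unweighted `B`), NOT proved here: reindexing
(`indepArch_of_archCore`), elimination of multiplicative relations (`depArch_of_indepArch`) and
Evertse–Győry §4.4.2 at `α = 1` (`archApproximationBound_rat_of_depArch`).
[cite: Pasten2024, Theorem 2.1 (i) (d = 1)] [cite: Nesterenko2003, Thm 2.2]
[cite: EvertseGyory2015, Thm 4.2.1 (p. 68), proof pp. 80–81] -/
theorem archApproximationBound_rat_of_archCore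
    (hArch : ∃ c : ℝ, ∀ (r : ℕ) (a : Fin r → ℚ) (b : Fin r → ℤ) (A : Fin r → ℝ) (B : ℝ),
      (∀ i, 0 < a i) →
      (∀ μ : Fin r → ℤ, ∏ i, a i ^ μ i = 1 → μ = 0) →
      (∀ i, Height.logHeight₁ (a i) ≤ A i) → (∀ i, 1 ≤ A i) →
      b ≠ 0 → (∀ i, (|b i| : ℝ) ≤ B) →
      -(c ^ r * (∏ i, A i) * Real.log (Real.exp 1 * B)) ≤
        Real.log |∑ i, (b i : ℝ) * Real.log (a i : ℝ)|) :
    archApproximationBound_rat := by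
  obtain ⟨c, hc⟩ := hArch
  set C₀ : ℝ := max 1 |c| with hC₀
  have hC₀1 : 1 ≤ C₀ := le_max_left _ _
  have hl2 : 0 < Real.log 2 := Real.log_pos one_lt_two
  have hC : 1 ≤ (C₀ + 3) / Real.log 2 := by
    rw [le_div_iff₀ hl2]; linarith [Real.log_two_lt_d9]
  refine archApproximationBound_rat_of_depArch hC fun κ _ _ a b B ha ha1 hB hB3 hne => ?_
  exact depArch_of_indepArch hC₀1 (fun κ' _ _ a' b' A B' ha' hind hA hA1 hb' hB' =>
    indepArch_of_archCore hc le_rfl κ' a' b' A B' ha' hind hA hA1 hb' hB') κ a b B ha ha1 hB hB3 hne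

/-- **The approximation bound over `ℚ` in shape form ("A1.L": `∃ K ≥ 1, PastenApproximationBound K`,
Pasten 2024 Thm 2.1, `d = 1`) from the three engine texts in shape form** — the archimedean core
(Nesterenko/Matveev over `ℚ`), the odd-`p` core and the `2`-adic core (Yu 2007 over `ℚ`), all with
unspecified absolute constants and NOT proved here: the two halves
(`archApproximationBound_rat_of_archCore`, `padicApproximationBound_rat_of_padicCores`) joined by
`approximationBound_rat_of_halves`. Every `…_of_approximationBound` consumer in the tree is
`K`-parametric, hence a theorem the day the three cores are.
[cite: Pasten2024, Theorem 2.1 (d = 1)] [cite: EvertseGyory2015, Thm 4.2.1 (p. 68)] -/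
theorem approximationBound_rat_of_cores
    (hArch : ∃ c : ℝ, ∀ (r : ℕ) (a : Fin r → ℚ) (b : Fin r → ℤ) (A : Fin r → ℝ) (B : ℝ),
      (∀ i, 0 < a i) →
      (∀ μ : Fin r → ℤ, ∏ i, a i ^ μ i = 1 → μ = 0) →
      (∀ i, Height.logHeight₁ (a i) ≤ A i) → (∀ i, 1 ≤ A i) →
      b ≠ 0 → (∀ i, (|b i| : ℝ) ≤ B) →
      -(c ^ r * (∏ i, A i) * Real.log (Real.exp 1 * B)) ≤
        Real.log |∑ i, (b i : ℝ) * Real.log (a i : ℝ)|)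
    (hOdd : ∃ c : ℝ, ∀ (p : ℕ), p.Prime → p ≠ 2 →
      ∀ (r : ℕ) (θ : Fin r → ℚ) (m : Fin r → ℤ) (A : Fin r → ℝ) (Amax W : ℝ),
      (∀ i, θ i ≠ 0 ∧ padicValRat p (θ i) = 0) →
      (∀ μ : Fin r → ℤ, ∏ i, θ i ^ μ i = 1 → μ = 0) →
      (∀ i, Height.logHeight₁ (θ i) ≤ A i) → (∀ i, 1 ≤ A i) → (∀ i, A i ≤ Amax) →
      m ≠ 0 → (∀ i, Real.log (max 3 (|m i| : ℝ)) ≤ W) → 1 ≤ W →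
      (padicValRat p (∏ i, θ i ^ m i - 1) : ℝ) * Real.log p ≤
        c ^ r * ((p : ℝ) / Real.log p) * (∏ i, A i) * (W + Real.log p + Real.log (2 * Amax)))
    (hTwo : ∃ c : ℝ, ∀ (r : ℕ) (θ : Fin r → ℚ) (m : Fin r → ℤ) (A : Fin r → ℝ) (Amax W : ℝ),
      (∀ i, 3 ≤ padicValRat 2 (θ i - 1)) →
      (∀ μ : Fin r → ℤ, ∏ i, θ i ^ μ i = 1 → μ = 0) →
      (∀ i, Height.logHeight₁ (θ i) ≤ A i) → (∀ i, 1 ≤ A i) → (∀ i, A i ≤ Amax) →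
      m ≠ 0 → (∀ i, Real.log (max 3 (|m i| : ℝ)) ≤ W) → 1 ≤ W →
      (padicValRat 2 (∏ i, θ i ^ m i - 1) : ℝ) ≤ c ^ r * (∏ i, A i) * (W + Real.log (2 * Amax))) :
    approximationBound_rat :=
  approximationBound_rat_of_halves (archApproximationBound_rat_of_archCore hArch)
    (padicApproximationBound_rat_of_padicCores hOdd hTwo)

end Literature.NumberTheory.DiophantineGeometry.Dioph

end
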